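import Literature.Algebra.Polynomial.CasasAlvero.Char271Digits
import Literature.Algebra.Polynomial.CasasAlvero.Char271DigitsHigh
import Literature.Algebra.Polynomial.CasasAlvero.Degree6CandidatesPrime
import Literature.Algebra.Polynomial.CasasAlvero.Degree5
import Literature.Algebra.Polynomial.CasasAlvero.Degree6
import Literature.Algebra.Polynomial.CasasAlvero.DigitReduction
import HarnessLib

/-!
# Casas-Alvero degrees in characteristic 271: the complete classification

Over EVERY field `K` of characteristic `271`: `CA_d(K) ⟺ d = 0 ∨ d = a·271^k` with `1 ≤ a ≤ 6`.
Ingredients: the digit reduction `CA_d ⇒ d = a·p^k ∧ CA_a` (`DigitReduction.lean`, any field); the positive digits `1, 2, 3, 4`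
([GrafVonBothmerEtAl2007, Props. 2, 6]), `5` (`Degree5.lean`) and `6` (`271` is not among the `54` candidate bad primes of degree `6` of `Degree6CandidatesPrime.lean`, so `CA_6` holds in characteristic `271` —
a GOOD prime for degree `6` [CastryckLaterveerOunaies2012, Thm. 4] — and `CA_{6·p^k}` descends from the algebraic closure); and a refutation of every digit `7 ≤ a ≤ 270` over every field of characteristic `271`:
`7` by the sparse `𝔽_271`-septic of `Char271Digits.lean` (the degree-7 table of `BadDegrees.lean` stops at `61`); `33, 34, 38, 47, 81, 87, 90, 95, 110, 117, 129, 137, 144, 145, 146, 148, 166, 168, 171, 172, 173, 187, 191, 192, 194, 196, 197, 202, 208, 209, 210, 211, 223, 226, 233, 234, 237, 242, 243, 249, 252, 254, 255, 258, 260, 265, 266, 270` by the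
binomial criterion (`m = 12, 16, 10, 20, 22, 14, 39, 47, 12, 20, 4, 27, 7, 4, 21, 67, 81, 11, 33, 12, 20, 21, 15, 37, 53, 36, 14, 63, 25, 61, 89, 22, 48, 71, 5, 74, 99, 10, 20, 12, 16, 18, 79, 98, 28, 37, 29, 2`); and the 215 remaining digits by the sparse `𝔽_271`-examples of `Char271Digits.lean` and `Char271DigitsHigh.lean`.
-/

noncomputable section

open Polynomial

set_option maxRecDepth 8192

namespace Literature.Algebra.Polynomial.CasasAlvero

variable (K : Type*) [Field K] [CharP K 271]


/-- `CA_{6·271^k}` over every field of characteristic `271` (`CA_6` itself — the case `k = 0` — holds because `271` is not among the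
`54` candidate bad primes of degree `6` of `Degree6CandidatesPrime.lean`, `holdsInDegree_six_of_not_mem`, i.e. `271` is a GOOD prime for degree `6`
[cite: CastryckLaterveerOunaies2012, Thm. 4]). [cite: GrafVonBothmerEtAl2007, Prop. 6] -/
theorem holdsInDegree_six_mul_pow_of_char_271' (k : ℕ) : HoldsInDegree K (6 * 271 ^ k) := by
  haveI : Fact (Nat.Prime 271) := ⟨by norm_num⟩
  exact holdsInDegree_mul_prime_pow_field K 271 (holdsInDegree_six_of_not_mem (K := AlgebraicClosure K) 271 (by decide)) k

set_option maxHeartbeats 1000000 in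
/-- every digit `7 ≤ a < 271` fails: `¬ CA_a` over every field of characteristic `271` — the bad-prime computations of
[cite: CastryckLaterveerOunaies2012, Thm. 4] (degrees `≤ 7`) extended to every digit below `271` by explicit `𝔽_271`-rational examples and the binomial
criterion. [cite: GrafVonBothmerEtAl2007, Prop. 6] -/
theorem not_holdsInDegree_digit_of_char_twoHundredSeventyOne {a : ℕ} (h7 : 7 ≤ a) (hap : a < 271) : ¬ HoldsInDegree K a := by
  haveI : Fact (Nat.Prime 271) := ⟨by norm_num⟩
  interval_cases a
  · exact not_holdsInDegree_seven_of_char_271 K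
  · exact not_holdsInDegree_eight_of_char_271 K
  · exact not_holdsInDegree_nine_of_char_271 K
  · exact not_holdsInDegree_ten_of_char_271 K
  · exact not_holdsInDegree_eleven_of_char_271 K
  · exact not_holdsInDegree_twelve_of_char_271 K
  · exact not_holdsInDegree_thirteen_of_char_271 K
  · exact not_holdsInDegree_fourteen_of_char_271 K
  · exact not_holdsInDegree_fifteen_of_char_271 K
  · exact not_holdsInDegree_sixteen_of_char_271 K
  · exact not_holdsInDegree_seventeen_of_char_271 K
  · exact not_holdsInDegree_eighteen_of_char_271 K
  · exact not_holdsInDegree_nineteen_of_char_271 K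
  · exact not_holdsInDegree_twenty_of_char_271 K
  · exact not_holdsInDegree_twentyOne_of_char_271 K
  · exact not_holdsInDegree_twentyTwo_of_char_271 K
  · exact not_holdsInDegree_twentyThree_of_char_271 K
  · exact not_holdsInDegree_twentyFour_of_char_271 K
  · exact not_holdsInDegree_twentyFive_of_char_271 K
  · exact not_holdsInDegree_twentySix_of_char_271 K
  · exact not_holdsInDegree_twentySeven_of_char_271 K
  · exact not_holdsInDegree_twentyEight_of_char_271 K
  · exact not_holdsInDegree_twentyNine_of_char_271 K
  · exact not_holdsInDegree_thirty_of_char_271 K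
  · exact not_holdsInDegree_thirtyOne_of_char_271 K
  · exact not_holdsInDegree_thirtyTwo_of_char_271 K
  · exact not_holdsInDegree_of_choose_modEq_one K 271 (d := 33) (m := 12) (by norm_num) (by norm_num) (by decide)
  · exact not_holdsInDegree_of_choose_modEq_one K 271 (d := 34) (m := 16) (by norm_num) (by norm_num) (by decide)
  · exact not_holdsInDegree_thirtyFive_of_char_271 K
  · exact not_holdsInDegree_thirtySix_of_char_271 K
  · exact not_holdsInDegree_thirtySeven_of_char_271 K
  · exact not_holdsInDegree_of_choose_modEq_one K 271 (d := 38) (m := 10) (by norm_num) (by norm_num) (by decide)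
  · exact not_holdsInDegree_thirtyNine_of_char_271 K
  · exact not_holdsInDegree_forty_of_char_271 K
  · exact not_holdsInDegree_fortyOne_of_char_271 K
  · exact not_holdsInDegree_fortyTwo_of_char_271 K
  · exact not_holdsInDegree_fortyThree_of_char_271 K
  · exact not_holdsInDegree_fortyFour_of_char_271 K
  · exact not_holdsInDegree_fortyFive_of_char_271 K
  · exact not_holdsInDegree_fortySix_of_char_271 K
  · exact not_holdsInDegree_of_choose_modEq_one K 271 (d := 47) (m := 20) (by norm_num) (by norm_num) (by decide)
  · exact not_holdsInDegree_fortyEight_of_char_271 K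
  · exact not_holdsInDegree_fortyNine_of_char_271 K
  · exact not_holdsInDegree_fifty_of_char_271 K
  · exact not_holdsInDegree_fiftyOne_of_char_271 K
  · exact not_holdsInDegree_fiftyTwo_of_char_271 K
  · exact not_holdsInDegree_fiftyThree_of_char_271 K
  · exact not_holdsInDegree_fiftyFour_of_char_271 K
  · exact not_holdsInDegree_fiftyFive_of_char_271 K
  · exact not_holdsInDegree_fiftySix_of_char_271 K
  · exact not_holdsInDegree_fiftySeven_of_char_271 K
  · exact not_holdsInDegree_fiftyEight_of_char_271 K
  · exact not_holdsInDegree_fiftyNine_of_char_271 K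
  · exact not_holdsInDegree_sixty_of_char_271 K
  · exact not_holdsInDegree_sixtyOne_of_char_271 K
  · exact not_holdsInDegree_sixtyTwo_of_char_271 K
  · exact not_holdsInDegree_sixtyThree_of_char_271 K
  · exact not_holdsInDegree_sixtyFour_of_char_271 K
  · exact not_holdsInDegree_sixtyFive_of_char_271 K
  · exact not_holdsInDegree_sixtySix_of_char_271 K
  · exact not_holdsInDegree_sixtySeven_of_char_271 K
  · exact not_holdsInDegree_sixtyEight_of_char_271 K
  · exact not_holdsInDegree_sixtyNine_of_char_271 K
  · exact not_holdsInDegree_seventy_of_char_271 K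
  · exact not_holdsInDegree_seventyOne_of_char_271 K
  · exact not_holdsInDegree_seventyTwo_of_char_271 K
  · exact not_holdsInDegree_seventyThree_of_char_271 K
  · exact not_holdsInDegree_seventyFour_of_char_271 K
  · exact not_holdsInDegree_seventyFive_of_char_271 K
  · exact not_holdsInDegree_seventySix_of_char_271 K
  · exact not_holdsInDegree_seventySeven_of_char_271 K
  · exact not_holdsInDegree_seventyEight_of_char_271 K
  · exact not_holdsInDegree_seventyNine_of_char_271 K
  · exact not_holdsInDegree_eighty_of_char_271 K
  · exact not_holdsInDegree_of_choose_modEq_one K 271 (d := 81) (m := 22) (by norm_num) (by norm_num) (by decide)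
  · exact not_holdsInDegree_eightyTwo_of_char_271 K
  · exact not_holdsInDegree_eightyThree_of_char_271 K
  · exact not_holdsInDegree_eightyFour_of_char_271 K
  · exact not_holdsInDegree_eightyFive_of_char_271 K
  · exact not_holdsInDegree_eightySix_of_char_271 K
  · exact not_holdsInDegree_of_choose_modEq_one K 271 (d := 87) (m := 14) (by norm_num) (by norm_num) (by decide)
  · exact not_holdsInDegree_eightyEight_of_char_271 K
  · exact not_holdsInDegree_eightyNine_of_char_271 K
  · exact not_holdsInDegree_of_choose_modEq_one K 271 (d := 90) (m := 39) (by norm_num) (by norm_num) (by decide)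
  · exact not_holdsInDegree_ninetyOne_of_char_271 K
  · exact not_holdsInDegree_ninetyTwo_of_char_271 K
  · exact not_holdsInDegree_ninetyThree_of_char_271 K
  · exact not_holdsInDegree_ninetyFour_of_char_271 K
  · exact not_holdsInDegree_of_choose_modEq_one K 271 (d := 95) (m := 47) (by norm_num) (by norm_num) (by decide)
  · exact not_holdsInDegree_ninetySix_of_char_271 K
  · exact not_holdsInDegree_ninetySeven_of_char_271 K
  · exact not_holdsInDegree_ninetyEight_of_char_271 K
  · exact not_holdsInDegree_ninetyNine_of_char_271 K
  · exact not_holdsInDegree_oneHundred_of_char_271 K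
  · exact not_holdsInDegree_oneHundredOne_of_char_271 K
  · exact not_holdsInDegree_oneHundredTwo_of_char_271 K
  · exact not_holdsInDegree_oneHundredThree_of_char_271 K
  · exact not_holdsInDegree_oneHundredFour_of_char_271 K
  · exact not_holdsInDegree_oneHundredFive_of_char_271 K
  · exact not_holdsInDegree_oneHundredSix_of_char_271 K
  · exact not_holdsInDegree_oneHundredSeven_of_char_271 K
  · exact not_holdsInDegree_oneHundredEight_of_char_271 K
  · exact not_holdsInDegree_oneHundredNine_of_char_271 K
  · exact not_holdsInDegree_of_choose_modEq_one K 271 (d := 110) (m := 12) (by norm_num) (by norm_num) (by decide)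
  · exact not_holdsInDegree_oneHundredEleven_of_char_271 K
  · exact not_holdsInDegree_oneHundredTwelve_of_char_271 K
  · exact not_holdsInDegree_oneHundredThirteen_of_char_271 K
  · exact not_holdsInDegree_oneHundredFourteen_of_char_271 K
  · exact not_holdsInDegree_oneHundredFifteen_of_char_271 K
  · exact not_holdsInDegree_oneHundredSixteen_of_char_271 K
  · exact not_holdsInDegree_of_choose_modEq_one K 271 (d := 117) (m := 20) (by norm_num) (by norm_num) (by decide)
  · exact not_holdsInDegree_oneHundredEighteen_of_char_271 K
  · exact not_holdsInDegree_oneHundredNineteen_of_char_271 K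
  · exact not_holdsInDegree_oneHundredTwenty_of_char_271 K
  · exact not_holdsInDegree_oneHundredTwentyOne_of_char_271 K
  · exact not_holdsInDegree_oneHundredTwentyTwo_of_char_271 K
  · exact not_holdsInDegree_oneHundredTwentyThree_of_char_271 K
  · exact not_holdsInDegree_oneHundredTwentyFour_of_char_271 K
  · exact not_holdsInDegree_oneHundredTwentyFive_of_char_271 K
  · exact not_holdsInDegree_oneHundredTwentySix_of_char_271 K
  · exact not_holdsInDegree_oneHundredTwentySeven_of_char_271 K
  · exact not_holdsInDegree_oneHundredTwentyEight_of_char_271 K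
  · exact not_holdsInDegree_of_choose_modEq_one K 271 (d := 129) (m := 4) (by norm_num) (by norm_num) (by decide)
  · exact not_holdsInDegree_oneHundredThirty_of_char_271 K
  · exact not_holdsInDegree_oneHundredThirtyOne_of_char_271 K
  · exact not_holdsInDegree_oneHundredThirtyTwo_of_char_271 K
  · exact not_holdsInDegree_oneHundredThirtyThree_of_char_271 K
  · exact not_holdsInDegree_oneHundredThirtyFour_of_char_271 K
  · exact not_holdsInDegree_oneHundredThirtyFive_of_char_271 K
  · exact not_holdsInDegree_oneHundredThirtySix_of_char_271 K
  · exact not_holdsInDegree_of_choose_modEq_one K 271 (d := 137) (m := 27) (by norm_num) (by norm_num) (by decide)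
  · exact not_holdsInDegree_oneHundredThirtyEight_of_char_271 K
  · exact not_holdsInDegree_oneHundredThirtyNine_of_char_271 K
  · exact not_holdsInDegree_oneHundredForty_of_char_271 K
  · exact not_holdsInDegree_oneHundredFortyOne_of_char_271 K
  · exact not_holdsInDegree_oneHundredFortyTwo_of_char_271 K
  · exact not_holdsInDegree_oneHundredFortyThree_of_char_271 K
  · exact not_holdsInDegree_of_choose_modEq_one K 271 (d := 144) (m := 7) (by norm_num) (by norm_num) (by decide)
  · exact not_holdsInDegree_of_choose_modEq_one K 271 (d := 145) (m := 4) (by norm_num) (by norm_num) (by decide)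
  · exact not_holdsInDegree_of_choose_modEq_one K 271 (d := 146) (m := 21) (by norm_num) (by norm_num) (by decide)
  · exact not_holdsInDegree_oneHundredFortySeven_of_char_271 K
  · exact not_holdsInDegree_of_choose_modEq_one K 271 (d := 148) (m := 67) (by norm_num) (by norm_num) (by decide)
  · exact not_holdsInDegree_oneHundredFortyNine_of_char_271 K
  · exact not_holdsInDegree_oneHundredFifty_of_char_271 K
  · exact not_holdsInDegree_oneHundredFiftyOne_of_char_271 K
  · exact not_holdsInDegree_oneHundredFiftyTwo_of_char_271 K
  · exact not_holdsInDegree_oneHundredFiftyThree_of_char_271 K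
  · exact not_holdsInDegree_oneHundredFiftyFour_of_char_271 K
  · exact not_holdsInDegree_oneHundredFiftyFive_of_char_271 K
  · exact not_holdsInDegree_oneHundredFiftySix_of_char_271 K
  · exact not_holdsInDegree_oneHundredFiftySeven_of_char_271 K
  · exact not_holdsInDegree_oneHundredFiftyEight_of_char_271 K
  · exact not_holdsInDegree_oneHundredFiftyNine_of_char_271 K
  · exact not_holdsInDegree_oneHundredSixty_of_char_271 K
  · exact not_holdsInDegree_oneHundredSixtyOne_of_char_271 K
  · exact not_holdsInDegree_oneHundredSixtyTwo_of_char_271 K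
  · exact not_holdsInDegree_oneHundredSixtyThree_of_char_271 K
  · exact not_holdsInDegree_oneHundredSixtyFour_of_char_271 K
  · exact not_holdsInDegree_oneHundredSixtyFive_of_char_271 K
  · exact not_holdsInDegree_of_choose_modEq_one K 271 (d := 166) (m := 81) (by norm_num) (by norm_num) (by decide)
  · exact not_holdsInDegree_oneHundredSixtySeven_of_char_271 K
  · exact not_holdsInDegree_of_choose_modEq_one K 271 (d := 168) (m := 11) (by norm_num) (by norm_num) (by decide)
  · exact not_holdsInDegree_oneHundredSixtyNine_of_char_271 K
  · exact not_holdsInDegree_oneHundredSeventy_of_char_271 K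
  · exact not_holdsInDegree_of_choose_modEq_one K 271 (d := 171) (m := 33) (by norm_num) (by norm_num) (by decide)
  · exact not_holdsInDegree_of_choose_modEq_one K 271 (d := 172) (m := 12) (by norm_num) (by norm_num) (by decide)
  · exact not_holdsInDegree_of_choose_modEq_one K 271 (d := 173) (m := 20) (by norm_num) (by norm_num) (by decide)
  · exact not_holdsInDegree_oneHundredSeventyFour_of_char_271 K
  · exact not_holdsInDegree_oneHundredSeventyFive_of_char_271 K
  · exact not_holdsInDegree_oneHundredSeventySix_of_char_271 K
  · exact not_holdsInDegree_oneHundredSeventySeven_of_char_271 K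
  · exact not_holdsInDegree_oneHundredSeventyEight_of_char_271 K
  · exact not_holdsInDegree_oneHundredSeventyNine_of_char_271 K
  · exact not_holdsInDegree_oneHundredEighty_of_char_271 K
  · exact not_holdsInDegree_oneHundredEightyOne_of_char_271 K
  · exact not_holdsInDegree_oneHundredEightyTwo_of_char_271 K
  · exact not_holdsInDegree_oneHundredEightyThree_of_char_271 K
  · exact not_holdsInDegree_oneHundredEightyFour_of_char_271 K
  · exact not_holdsInDegree_oneHundredEightyFive_of_char_271 K
  · exact not_holdsInDegree_oneHundredEightySix_of_char_271 K
  · exact not_holdsInDegree_of_choose_modEq_one K 271 (d := 187) (m := 21) (by norm_num) (by norm_num) (by decide)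
  · exact not_holdsInDegree_oneHundredEightyEight_of_char_271 K
  · exact not_holdsInDegree_oneHundredEightyNine_of_char_271 K
  · exact not_holdsInDegree_oneHundredNinety_of_char_271 K
  · exact not_holdsInDegree_of_choose_modEq_one K 271 (d := 191) (m := 15) (by norm_num) (by norm_num) (by decide)
  · exact not_holdsInDegree_of_choose_modEq_one K 271 (d := 192) (m := 37) (by norm_num) (by norm_num) (by decide)
  · exact not_holdsInDegree_oneHundredNinetyThree_of_char_271 K
  · exact not_holdsInDegree_of_choose_modEq_one K 271 (d := 194) (m := 53) (by norm_num) (by norm_num) (by decide)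
  · exact not_holdsInDegree_oneHundredNinetyFive_of_char_271 K
  · exact not_holdsInDegree_of_choose_modEq_one K 271 (d := 196) (m := 36) (by norm_num) (by norm_num) (by decide)
  · exact not_holdsInDegree_of_choose_modEq_one K 271 (d := 197) (m := 14) (by norm_num) (by norm_num) (by decide)
  · exact not_holdsInDegree_oneHundredNinetyEight_of_char_271 K
  · exact not_holdsInDegree_oneHundredNinetyNine_of_char_271 K
  · exact not_holdsInDegree_twoHundred_of_char_271 K
  · exact not_holdsInDegree_twoHundredOne_of_char_271 K
  · exact not_holdsInDegree_of_choose_modEq_one K 271 (d := 202) (m := 63) (by norm_num) (by norm_num) (by decide)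
  · exact not_holdsInDegree_twoHundredThree_of_char_271 K
  · exact not_holdsInDegree_twoHundredFour_of_char_271 K
  · exact not_holdsInDegree_twoHundredFive_of_char_271 K
  · exact not_holdsInDegree_twoHundredSix_of_char_271 K
  · exact not_holdsInDegree_twoHundredSeven_of_char_271 K
  · exact not_holdsInDegree_of_choose_modEq_one K 271 (d := 208) (m := 25) (by norm_num) (by norm_num) (by decide)
  · exact not_holdsInDegree_of_choose_modEq_one K 271 (d := 209) (m := 61) (by norm_num) (by norm_num) (by decide)
  · exact not_holdsInDegree_of_choose_modEq_one K 271 (d := 210) (m := 89) (by norm_num) (by norm_num) (by decide)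
  · exact not_holdsInDegree_of_choose_modEq_one K 271 (d := 211) (m := 22) (by norm_num) (by norm_num) (by decide)
  · exact not_holdsInDegree_twoHundredTwelve_of_char_271 K
  · exact not_holdsInDegree_twoHundredThirteen_of_char_271 K
  · exact not_holdsInDegree_twoHundredFourteen_of_char_271 K
  · exact not_holdsInDegree_twoHundredFifteen_of_char_271 K
  · exact not_holdsInDegree_twoHundredSixteen_of_char_271 K
  · exact not_holdsInDegree_twoHundredSeventeen_of_char_271 K
  · exact not_holdsInDegree_twoHundredEighteen_of_char_271 K
  · exact not_holdsInDegree_twoHundredNineteen_of_char_271 K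
  · exact not_holdsInDegree_twoHundredTwenty_of_char_271 K
  · exact not_holdsInDegree_twoHundredTwentyOne_of_char_271 K
  · exact not_holdsInDegree_twoHundredTwentyTwo_of_char_271 K
  · exact not_holdsInDegree_of_choose_modEq_one K 271 (d := 223) (m := 48) (by norm_num) (by norm_num) (by decide)
  · exact not_holdsInDegree_twoHundredTwentyFour_of_char_271 K
  · exact not_holdsInDegree_twoHundredTwentyFive_of_char_271 K
  · exact not_holdsInDegree_of_choose_modEq_one K 271 (d := 226) (m := 71) (by norm_num) (by norm_num) (by decide)
  · exact not_holdsInDegree_twoHundredTwentySeven_of_char_271 K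
  · exact not_holdsInDegree_twoHundredTwentyEight_of_char_271 K
  · exact not_holdsInDegree_twoHundredTwentyNine_of_char_271 K
  · exact not_holdsInDegree_twoHundredThirty_of_char_271 K
  · exact not_holdsInDegree_twoHundredThirtyOne_of_char_271 K
  · exact not_holdsInDegree_twoHundredThirtyTwo_of_char_271 K
  · exact not_holdsInDegree_of_choose_modEq_one K 271 (d := 233) (m := 5) (by norm_num) (by norm_num) (by decide)
  · exact not_holdsInDegree_of_choose_modEq_one K 271 (d := 234) (m := 74) (by norm_num) (by norm_num) (by decide)
  · exact not_holdsInDegree_twoHundredThirtyFive_of_char_271 K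
  · exact not_holdsInDegree_twoHundredThirtySix_of_char_271 K
  · exact not_holdsInDegree_of_choose_modEq_one K 271 (d := 237) (m := 99) (by norm_num) (by norm_num) (by decide)
  · exact not_holdsInDegree_twoHundredThirtyEight_of_char_271 K
  · exact not_holdsInDegree_twoHundredThirtyNine_of_char_271 K
  · exact not_holdsInDegree_twoHundredForty_of_char_271 K
  · exact not_holdsInDegree_twoHundredFortyOne_of_char_271 K
  · exact not_holdsInDegree_of_choose_modEq_one K 271 (d := 242) (m := 10) (by norm_num) (by norm_num) (by decide)
  · exact not_holdsInDegree_of_choose_modEq_one K 271 (d := 243) (m := 20) (by norm_num) (by norm_num) (by decide)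
  · exact not_holdsInDegree_twoHundredFortyFour_of_char_271 K
  · exact not_holdsInDegree_twoHundredFortyFive_of_char_271 K
  · exact not_holdsInDegree_twoHundredFortySix_of_char_271 K
  · exact not_holdsInDegree_twoHundredFortySeven_of_char_271 K
  · exact not_holdsInDegree_twoHundredFortyEight_of_char_271 K
  · exact not_holdsInDegree_of_choose_modEq_one K 271 (d := 249) (m := 12) (by norm_num) (by norm_num) (by decide)
  · exact not_holdsInDegree_twoHundredFifty_of_char_271 K
  · exact not_holdsInDegree_twoHundredFiftyOne_of_char_271 K
  · exact not_holdsInDegree_of_choose_modEq_one K 271 (d := 252) (m := 16) (by norm_num) (by norm_num) (by decide)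
  · exact not_holdsInDegree_twoHundredFiftyThree_of_char_271 K
  · exact not_holdsInDegree_of_choose_modEq_one K 271 (d := 254) (m := 18) (by norm_num) (by norm_num) (by decide)
  · exact not_holdsInDegree_of_choose_modEq_one K 271 (d := 255) (m := 79) (by norm_num) (by norm_num) (by decide)
  · exact not_holdsInDegree_twoHundredFiftySix_of_char_271 K
  · exact not_holdsInDegree_twoHundredFiftySeven_of_char_271 K
  · exact not_holdsInDegree_of_choose_modEq_one K 271 (d := 258) (m := 98) (by norm_num) (by norm_num) (by decide)
  · exact not_holdsInDegree_twoHundredFiftyNine_of_char_271 K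
  · exact not_holdsInDegree_of_choose_modEq_one K 271 (d := 260) (m := 28) (by norm_num) (by norm_num) (by decide)
  · exact not_holdsInDegree_twoHundredSixtyOne_of_char_271 K
  · exact not_holdsInDegree_twoHundredSixtyTwo_of_char_271 K
  · exact not_holdsInDegree_twoHundredSixtyThree_of_char_271 K
  · exact not_holdsInDegree_twoHundredSixtyFour_of_char_271 K
  · exact not_holdsInDegree_of_choose_modEq_one K 271 (d := 265) (m := 37) (by norm_num) (by norm_num) (by decide)
  · exact not_holdsInDegree_of_choose_modEq_one K 271 (d := 266) (m := 29) (by norm_num) (by norm_num) (by decide)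
  · exact not_holdsInDegree_twoHundredSixtySeven_of_char_271 K
  · exact not_holdsInDegree_twoHundredSixtyEight_of_char_271 K
  · exact not_holdsInDegree_twoHundredSixtyNine_of_char_271 K
  · exact not_holdsInDegree_of_choose_modEq_one K 271 (d := 270) (m := 2) (by norm_num) (by norm_num) (by decide)

/-- the positive digits `1 ≤ a ≤ 5`: `CA_{a·271^k}` over every field of characteristic `271`. [cite: GrafVonBothmerEtAl2007, Props. 2, 6]
[cite: CastryckLaterveerOunaies2012, Thm. 4] -/
theorem holdsInDegree_mul_twoHundredSeventyOne_pow_of_le_five {a : ℕ} (ha0 : 0 < a) (ha5 : a ≤ 5) (k : ℕ) :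
    HoldsInDegree K (a * 271 ^ k) := by
  haveI : Fact (Nat.Prime 271) := ⟨by norm_num⟩
  interval_cases a
  · simpa using holdsInDegree_prime_pow_field K 271 k
  · exact holdsInDegree_two_mul_prime_pow_field K 271 k
  · exact holdsInDegree_three_mul_prime_pow_field K 271 (by norm_num) k
  · exact holdsInDegree_mul_prime_pow_field K 271
      (holdsInDegree_of_le_four_of_charP (AlgebraicClosure K) 271 (by norm_num) le_rfl) k
  · exact holdsInDegree_five_mul_prime_pow_field K 271 (by norm_num) (by norm_num) (by norm_num) (by norm_num)
      (by norm_num) (by norm_num) (by norm_num) (by norm_num) (by norm_num) k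

/-- **characteristic 271, complete**: over every field of characteristic `271`,
`CA_d ⟺ d = 0 ∨ d = a·271^k` with `1 ≤ a ≤ 6`. [cite: GrafVonBothmerEtAl2007, Props. 2, 6, 7]
[cite: CastryckLaterveerOunaies2012, Thm. 4] -/
theorem classification_char_twoHundredSeventyOne_complete (d : ℕ) :
    HoldsInDegree K d ↔ d = 0 ∨ ∃ k a : ℕ, 0 < a ∧ a ≤ 6 ∧ d = a * 271 ^ k := by
  haveI : Fact (Nat.Prime 271) := ⟨by norm_num⟩
  constructor
  · intro h
    rcases Nat.eq_zero_or_pos d with rfl | hd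
    · exact Or.inl rfl
    obtain ⟨k, a, ha0, hap, rfl, ha⟩ := digit_of_holdsInDegree K 271 hd.ne' h
    refine Or.inr ⟨k, a, ha0, ?_, rfl⟩
    by_contra h6
    exact not_holdsInDegree_digit_of_char_twoHundredSeventyOne K (by omega) hap ha
  · rintro (rfl | ⟨k, a, ha0, ha6, rfl⟩)
    · exact holdsInDegree_zero K
    · rcases Nat.lt_or_ge a 6 with ha | ha
      · exact holdsInDegree_mul_twoHundredSeventyOne_pow_of_le_five K ha0 (by omega) k
      · obtain rfl : a = 6 := le_antisymm ha6 ha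
        exact holdsInDegree_six_mul_pow_of_char_271' K k

/-- the set of Casas-Alvero degrees `≤ 73441` in characteristic `271`, explicitly (corollary of the classification:
[cite: GrafVonBothmerEtAl2007, Prop. 6] with [cite: CastryckLaterveerOunaies2012, Thm. 4] and the digit refutations above). -/
theorem holdsInDegree_iff_mem_of_le_char_twoHundredSeventyOne_sq {d : ℕ} (hd : d ≤ 73441) :
    HoldsInDegree K d ↔ d ∈ ({0, 1, 2, 3, 4, 5, 6, 271, 542, 813, 1084, 1355, 1626, 73441} : Finset ℕ) := by
  rw [classification_char_twoHundredSeventyOne_complete]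
  constructor
  · rintro (rfl | ⟨k, a, ha0, ha6, rfl⟩)
    · decide
    · rcases k with _ | _ | _ | k
      · interval_cases a <;> decide
      · interval_cases a <;> decide
      · interval_cases a <;> simp_all
      · exfalso
        have : 271 ^ 3 ≤ a * 271 ^ (k + 1 + 1 + 1) :=
          le_trans (Nat.pow_le_pow_right (by norm_num) (by omega)) (Nat.le_mul_of_pos_left _ ha0)
        omega
  · intro h
    simp only [Finset.mem_insert, Finset.mem_singleton] at h
    rcases h with rfl | rfl | rfl | rfl | rfl | rfl | rfl | rfl | rfl | rfl | rfl | rfl | rfl | rfl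
    · exact Or.inl rfl
    · exact Or.inr ⟨0, 1, by norm_num, by norm_num, by norm_num⟩
    · exact Or.inr ⟨0, 2, by norm_num, by norm_num, by norm_num⟩
    · exact Or.inr ⟨0, 3, by norm_num, by norm_num, by norm_num⟩
    · exact Or.inr ⟨0, 4, by norm_num, by norm_num, by norm_num⟩
    · exact Or.inr ⟨0, 5, by norm_num, by norm_num, by norm_num⟩
    · exact Or.inr ⟨0, 6, by norm_num, by norm_num, by norm_num⟩
    · exact Or.inr ⟨1, 1, by norm_num, by norm_num, by norm_num⟩
    · exact Or.inr ⟨1, 2, by norm_num, by norm_num, by norm_num⟩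
    · exact Or.inr ⟨1, 3, by norm_num, by norm_num, by norm_num⟩
    · exact Or.inr ⟨1, 4, by norm_num, by norm_num, by norm_num⟩
    · exact Or.inr ⟨1, 5, by norm_num, by norm_num, by norm_num⟩
    · exact Or.inr ⟨1, 6, by norm_num, by norm_num, by norm_num⟩
    · exact Or.inr ⟨2, 1, by norm_num, by norm_num, by norm_num⟩

end Literature.Algebra.Polynomial.CasasAlvero
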